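import Summits.BirchSwinnertonDyer.BirchSwinnertonDyer.Theorems.SignedLowerHalvesSprungLowerDivisibilityAtThreeKatoSporadicOfCoprimality
import Literature.NumberTheory.EllipticCurves.Sprung2017.TraceCoordinateFunctionalEquationProofs
import HarnessLib

/-!
# Crux `SprungLowerDivisibilityAtThree` (item stmt-BirchSwinnertonDyer-19875), line `chromatic-common-zeros`:
# CHROMATIC COPRIMALITY ALONE implies the sporadic stub K_spor (class-wide), modulo the period unit ONLY —
# the trace-coordinate functional equation hypothesis of the lead's door is DISCHARGED

Cell `bsd-ssimc` (host) / width seat `cruxlead-stmt-BirchSwinnertonDyer-19875-w3` (gen 2); `--supports` 19875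
`--as helper`; theorems only; closes NO item. The lead's door
`ChromaticCommonZeros.stub_katoFineLowerSporadic_of_chromaticCoprimality (h3) (hF) (hS2)` (p619914: x8 child C1
⟹ child C1′ = v7/v8 stub K_spor, the sporadic common-zero locus being EMPTY once both colours are non-zero) took the
trace-coordinate functional equation `hF : Sprung2017.thm413_traceCoordinate_functionalEquation_three` as a displayed
hypothesis; that fact is now the THEOREM `thm413_traceCoordinate_functionalEquation_three_holds` (p621498), so the
door holds modulo the period unit `h3 : realPeriodRat_eq_unit_mul_plusPeriod_three` alone. HONEST FRAMING: one
application; K1 / BSD / leaf X8 are NOT proved; no summit statement is proved.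
-/

noncomputable section

open scoped Classical NumberField MatrixGroups ModularForm

open NumberField IsDedekindDomain CongruenceSubgroup WeierstrassCurve Field
  Literature.NumberTheory.EllipticCurves Literature.NumberTheory.EllipticCurves.ModularForms
  Literature.NumberTheory.EllipticCurves.ZpExtension Literature.NumberTheory.EllipticCurves.Sprung2017
  Literature.NumberTheory.EllipticCurves.Sprung2012 Literature.NumberTheory.EllipticCurves.Rank1Residual
  Literature.NumberTheory.EllipticCurves.IwasawaAlgebra Literature.NumberTheory.EllipticCurves.Kato2004
  Summit.BirchSwinnertonDyer.BirchSwinnertonDyer.Theorems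

namespace Summit.BirchSwinnertonDyer.BirchSwinnertonDyer.Theorems.ChromaticCommonZeros

/-- **Chromatic coprimality (S2 / x8 C1) ⟹ the sporadic stub K_spor (x8 C1′), class-wide, modulo the period
unit `h3` ONLY**: the lead's door `stub_katoFineLowerSporadic_of_chromaticCoprimality` with its functional-equation
hypothesis discharged by `thm413_traceCoordinate_functionalEquation_three_holds` (both colours are non-zero on X8
unconditionally, `ChromaticBothColours.ClassX8.sharp_ne_zero_and_flat_ne_zero`). `hS2` = registered v6 stub S2 /
x8 child C1 VERBATIM; conclusion = registered stub K_spor / x8 child C1′ VERBATIM. CONDITIONAL on `h3` (displayed);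
closes nothing. [cite: Sprung2015, Conj. 5.6] [cite: Sprung2017, Thm. 4.13 and Conj. 4.12]
[cite: Kato2004Asterisque, Conj. 12.10 (p. 224)] -/
theorem stub_katoFineLowerSporadic_of_chromaticCoprimality_of_periodUnit
    (h3 : realPeriodRat_eq_unit_mul_plusPeriod_three)
    (hS2 :
      ∀ (W : WeierstrassCurve ℚ) [W.IsElliptic] [W.IsGloballyMinimal] (p : ℕ) [Fact p.Prime],
        ClassX8 W p → ∀ (N : ℕ) (_ : NeZero N) (f : CuspForm (Gamma0 N) 2) (ϖ : ℚ)
          (Lsharp Lflat : IwasawaAlgebra p),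
        IsNewformOf W f → (ϖ : ℝ) * W.realPeriodRat = plusPeriod f →
        IsSprungPair f p (W.frobeniusTrace p) Lsharp Lflat → Lsharp ≠ 0 → Lflat ≠ 0 →
      ∀ (Gs Gf : IwasawaAlgebra p),
        iwasawaToPowerSeries p Gs =
          PowerSeries.C (ϖ : ℚ_[p]) * iwasawaToPowerSeries p (chromaticL Chroma.sharp Lsharp Lflat) →
        iwasawaToPowerSeries p Gf =
          PowerSeries.C (ϖ : ℚ_[p]) * iwasawaToPowerSeries p (chromaticL Chroma.flat Lsharp Lflat) →
      ∀ 𝔭 : PrimeSpectrum (IwasawaAlgebra p), 𝔭.asIdeal.height = 1 →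
        Gs ∈ 𝔭.asIdeal → Gf ∈ 𝔭.asIdeal →
        (p : IwasawaAlgebra p) ∈ 𝔭.asIdeal ∨
          ∃ n : ℕ, ((cyclotomicOmega p n).map (Int.castRingHom ℤ_[p]) : PowerSeries ℤ_[p]) ∈ 𝔭.asIdeal) :
    ∀ (W : WeierstrassCurve ℚ) [W.IsElliptic] [W.IsGloballyMinimal] (p : ℕ) [Fact p.Prime]
      [ContinuousSMul ℤ_[p] (W.tateModule p)] [Module.Free ℤ_[p] (W.tateModule p)]
      [Module.Finite ℤ_[p] (W.tateModule p)],
      ClassX8 W p → ∀ (κ : ZpExtension ℚ p) (γ : Field.absoluteGaloisGroup ℚ),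
      κ.IsCyclotomic → κ.IsTopGenerator γ → IsCyclotomicVariable p γ →
    ∀ (v : HeightOneSpectrum (𝓞 ℚ)), (p : 𝓞 ℚ) ∈ v.asIdeal →
    ∀ (g : Field.absoluteGaloisGroup (v.adicCompletion ℚ)),
      κ.IsTopGenerator (resGalOfEmb (closureEmb (K := ℚ) (v.adicCompletion ℚ)) g) →
    ∀ (cneg : localPoints W (v.adicCompletion ℚ)) (c : ℕ → localPoints W (v.adicCompletion ℚ)),
      IsHondaSystem κ (closureEmb (K := ℚ) (v.adicCompletion ℚ)) W (W.frobeniusTrace p) g cneg c →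
    ∀ (N : ℕ) (_ : NeZero N) (f : CuspForm (Gamma0 N) 2) (ϖ : ℚ) (Lsharp Lflat : IwasawaAlgebra p),
      IsNewformOf W f → (ϖ : ℝ) * W.realPeriodRat = plusPeriod f →
      IsSprungPair f p (W.frobeniusTrace p) Lsharp Lflat →
    ∀ (I : Kato2004.IwasawaH1Data W p κ γ)
      (Cs : SharpFlatColemanKatoData W p f ϖ κ γ (closureEmb (K := ℚ) (v.adicCompletion ℚ))
        (W.frobeniusTrace p) g c Chroma.sharp I)
      (Cf : SharpFlatColemanKatoData W p f ϖ κ γ (closureEmb (K := ℚ) (v.adicCompletion ℚ))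
        (W.frobeniusTrace p) g c Chroma.flat I),
      Cs.Z = Cf.Z →
    ∀ (Y : W.FineSelmerDualData κ γ) (𝔭 : PrimeSpectrum (IwasawaAlgebra p)), 𝔭.asIdeal.height = 1 →
      (p : IwasawaAlgebra p) ∉ 𝔭.asIdeal →
      (¬ ∃ n : ℕ, ((cyclotomicOmega p n).map (Int.castRingHom ℤ_[p]) : PowerSeries ℤ_[p]) ∈ 𝔭.asIdeal) →
      (∀ (col' : Chroma) (G' : IwasawaAlgebra p),
        iwasawaToPowerSeries p G' =
          PowerSeries.C (ϖ : ℚ_[p]) * iwasawaToPowerSeries p (chromaticL col' Lsharp Lflat) →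
        G' ∈ 𝔭.asIdeal) →
      Module.lengthAt (IwasawaAlgebra p) (I.H ⧸ Cs.Z) 𝔭 ≤ Module.lengthAt (IwasawaAlgebra p) Y.X 𝔭 :=
  stub_katoFineLowerSporadic_of_chromaticCoprimality h3 thm413_traceCoordinate_functionalEquation_three_holds hS2

end Summit.BirchSwinnertonDyer.BirchSwinnertonDyer.Theorems.ChromaticCommonZeros

end
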